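import Mathlib
import HarnessLib
import HarnessLib.Audit
import Summits.HodgeConjecture.Statement
import Literature.AlgebraicGeometry.HodgeTheory.WeilClasses
import Literature.AlgebraicGeometry.HodgeTheory.ClassesSupportedOn
import Literature.AlgebraicTopology.SingularHomology.CupProduct

/-!
Route: NodalThetaWeil

DORMANT since 2026-09-02T13:25:28Z (reconciler: no traction for 5 d (last activity item-evidence-added at 2026-08-28T12:32:47Z); parked, not closed — `ledger route dormant route-HodgeConjecture-NodalThetaWeil --off` to reactivate) — unstaffed, not closed; items shared with open routes are served there. `ledger route dormant <id> --off` reactivates.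

# Route NodalThetaWeil — Weil classes on abelian sixfolds sit on nodal theta divisors; the node-dual
classes are the missing cycles

It suffices to show X = X1 ∧ X2 on abelian SIXFOLDS of Weil type (A, φ ≫ φ = −d·𝟙, K = ℚ(√−d) ↪
End⁰A), realising card theta-thimbles-weil-classes together with the conjunct its novelty audit
asked for. X1 (NodalThetaSupport): every Weil class w — rational, of type (3,3), in the Weil plane
E₊ ⊕ E₋ ⊂ H⁶(A(ℂ);ℂ) of HodgeTheory/WeilClasses — is supported on a proper Zariski-closed subset
(coniveau ≥ 1); sharp intended form (Thomas2005Nodes §4 + primitivity θ ∪ w = 0): on a NODAL member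
D ∈ |kΘ|, k ≥ 2, through a relation among its vanishing spheres whose thimble class has non-zero
W-projection — smooth members and Lefschetz-standard divisors are excluded. X2
(NodeDualClassesAlgebraic): a Weil class supported on a divisor is algebraic — by Thomas2005Nodes §3
/ DeligneHodgeIII1974 8.2.8 this is exactly the Hodge conjecture for the node-dual classes B̄ ∈
H^{2,2}(D̃⁵) of the resolved divisor (Schoen1985), Lefschetz (1,1) for fourfolds and OPEN for
sixfolds. X1 → X2 → WeilSixfolds (the shared target of TropicalCuspLift: Weil classes on abelian
sixfolds are algebraic, open off discriminant −1) is pure logic; WeilSixfolds → HodgeConjecture is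
the unclaimed complement.
Lean: `NodalThetaSupport ∧ NodeDualClassesAlgebraic`

## Assembly
Pure logic over syntactically identical binder blocks (checked sorry-free in the planner's
Sketch.lean, lean check rc 0, 2026-08-15): given the Weil-sixfold datum and a Weil class c,
NodalThetaSupport puts c in N¹H⁶, NodeDualClassesAlgebraic turns that into c ∈ algebraicClasses A.X
3 — this is WeilSixfolds (Sketch theorem thesis_implies_target) — and SixfoldSectorComplement
carries the sector to the summit. Conversely WeilSixfolds ⇒ NodalThetaSupport by
supportedClasses_mono (Sketch theorem nodalThetaSupport_of_target), so X1 and X2 are an honest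
equivalence split of the target with all the difficulty located. WeilClassesPrimitive and
FourfoldSupportedClassesAlgebraic are the design justification and the n = 2 calibration, not links
of the chain; the Tannakian detector and the blindness lemma (filed informally after open) steer the
search inside NodalThetaSupport.

Rationale: WHY THIS LINE. On an abelian variety the one divisor we are handed is Θ, and primitivity (typed
support WeilClassesPrimitive: a K-hermitian degree-2 class annihilates the Weil plane,
vanGeemen1994HodgeAV 4.9–4.11) says a Weil class meets every member of every |kΘ| homologically
invisibly and lives on the affine A∖Θ; by Thomas2005Nodes (READ pp.1–9) it can enter theta geometry
only through the NODES of singular members — relations among vanishing spheres of a nodal D ∈ |kΘ| —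
which is X1 in sharp form, attackable at k = 2 where nodal members are hyperplane sections tangent
to the Kummer variety K(A) ⊂ |2Θ|^∨ and the W-projector is a polynomial in the K-action (an exact,
period-free certificate). The card's audit (refuter r19) read Thomas pp.3–5 and flagged that Thm 1
is a GLOBAL equivalence: per class, nodal support only lifts w to a Hodge class B̄ ∈ H⁴(D̃⁵) and
needs HC one dimension down — Lefschetz (1,1) at n = 2, open at n = 3; this route files that
conjunct as the typed crux X2 (Schoen1985's problem specialised to nodal theta divisors, whose
expected cycles are threefolds through the nodes with maximal-isotropic tangent spaces for the
Hessian of ϑ). Imported areas: Picard–Lefschetz / vanishing-cycle topology (Thomas2005Nodes, Clemens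
double solids), Tannakian convolution of perverse sheaves on abelian varieties (arXiv:1111.4947,
arXiv:1309.3754, arXiv:1501.00226, arXiv:2210.05166) as a DETECTOR never yet pointed at Hodge
classes, and Beauville–Mukai Fourier duality for the blindness lemma; no spectral or probabilistic
reformulation (none touches algebraicity). Unlike route NodalSupport (MiddleDivisorSupport for all
X, a conditional bridge) and card thimble-lattice-nodal-certificates (fourfolds, where X2 is free),
the content here is abelian- and sixfold-specific; unlike HeckePrymWeil / WeilConeBoundary /
TropicalCuspLift it builds nothing at special K or at cusps but locates the class on (A, Θ) itself;
negatives index empty.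

RANKED CRUXES. #0 WeilSixfolds (target) — Weil classes on abelian sixfolds are algebraic: for d > 0,
A an abelian variety over ℂ of dimension 6 with φ ≫ φ = −d·𝟙, every rational (3,3)-class c = c₁ + c₂
with (x𝟙 + yφ)^* c₁ = (x + iy√d)⁶ c₁ and (x𝟙 + yφ)^* c₂ = (x − iy√d)⁶ c₂ for all x, y ∈ ℕ lies in
algebraicClasses A.X 3 — verbatim the shared item TropicalCuspLift.WeilSixfolds
(stmt-HodgeConjecture-2524), re-asked so this route attaches to it. (why it might fail: It is HC for
Weil classes on abelian sixfolds: open for every K off the discriminant −1 components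
(arXiv:2603.20268 §1; Markman2025SecantWeil did disc −1, Schoen ℚ(√−3) trivial disc); false iff one
of Weil's 1977 candidate counterexamples is real.) [vanGeemen1994HodgeAV, Weil1977HodgeRing,
Markman2025SecantWeil, arXiv:2603.20268, MoonenZarhin1999]
#2 NodalThetaSupport (crux) — (card C2, typed envelope) every Weil class on an abelian sixfold of
Weil type (A, φ ≫ φ = −d·𝟙) — rational, of type (3,3), in the Weil plane — lies in N¹H⁶: it is
supported on a proper Zariski-closed subset. Intended sharp form, informal until divisors/linear
systems are typed: the subset is a NODAL member D of |kΘ| for some k ≥ 2 and w enters through a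
relation Σ aᵢδᵢ = ∂Γ among the vanishing spheres of D whose thimble class has non-zero W-projection
(certificate Σ_j c_j⟨C,[k_j]_*C⟩ ≠ 0, π_W a polynomial in the K-action); by primitivity no smooth
member and no divisor with Lefschetz-standard H₆ can work; first regime k = 2 (hyperplane sections
tangent to the Kummer variety). [difficulty: open-problem] (why it might fail: Implied by HC(w), so
false only with HC; the informative failures are quantitative: Thomas's N is ineffective, level k =
2 (Kummer tangent hyperplanes) may carry no W-dependent vanishing spheres even for fourfolds, and no
coniveau-1 statement for an exceptional class has ever been proved directly.) [Thomas2005Nodes,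
vanGeemen1994HodgeAV, arXiv:1410.5868, Schoen1988HodgeWeil]
#3 NodeDualClassesAlgebraic (crux) — (the audit's missing conjunct) a Weil class on an abelian
sixfold of Weil type that IS supported on a proper Zariski-closed subset is algebraic. By
DeligneHodgeIII1974 Cor. 8.2.8 + semisimplicity the class is the Gysin image of a Hodge class B̄ ∈
H^{2,2}(D̃) on a resolution of the supporting divisor, and by Thomas2005Nodes §3 eq. (d) (=
Schoen1985 Lemma 1.1) for NODAL D the new Hodge classes of D̃⁵ are exactly the node-dual lattice ⟨Aᵢ
− Bᵢ⟩^* of relations among vanishing spheres; the statement is HC for those classes (their primitive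
projections, algebraic by Lieberman1968 B(A)), expected to be carried by threefolds V ⊂ D through
the nodes with T_pV maximal isotropic for the Hessian quadric. [deps: NodalThetaSupport]
[difficulty: open-problem] (why it might fail: It is HC(2,2) for node-dual classes of desingularised
nodal 5-folds of general type (Thomas2005Nodes §3; Schoen1985: 'a hard unsolved problem'); one
dimension down only Lefschetz (1,1) exists, so at n = 3 there is no method at all; false only with
HC.) [Thomas2005Nodes, Schoen1985, DeligneHodgeIII1974, Lieberman1968]
#9 WeilClassesPrimitive (support) — (card (P), provable now) for (A, φ ≫ φ = −d·𝟙) of dimension 2n,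
n ≥ 1, assuming the character decomposition of H^{2n+2}(A(ℂ);ℂ) into simultaneous (x𝟙 +
yφ)^*-eigenclasses of characters (x + iy√d)^a (x − iy√d)^b with a + b = 2n + 2, a, b ≤ 2n (=
∧^{2n+2}(V₊ ⊕ V₋), Kleiman1968AlgebraicCycles 2A8–2A11 / vanGeemen1994HodgeAV 4.9; dischargeable
once complexBetti is a Weil cohomology), every degree-2 class e with (x𝟙 + yφ)^* e = (x² + dy²) e (a
K-hermitian class, e.g. c₁ of any polarization with φ^*θ = dθ, i.e. whose Rosati involution induces
conjugation on K) satisfies e ∪ w = 0 for every w in the Weil plane: e ∪ w₊ is an eigenclass of the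
forbidden character (x + iy√d)^{2n+1}(x − iy√d), absent from the decomposition (distinct characters
of one operator (x₀𝟙 + φ)^* ⇒ independent eigenspaces). Consequences (informal): w is primitive; w
restricts to 0 on every SMOOTH ample divisor (Gysin is injective there), while on a NODAL D ∈ |kΘ|
its restriction to the resolution D̃ lies in the span of the differences Aᵢ − Bᵢ of the rulings of
the exceptional quadrics (Thomas2005Nodes eq. (dd)) — theta sees w only through its nodes; w is not
supported on any divisor whose H₆-image is Lefschetz-standard, and w survives on the affine A∖Θ
(Andreotti–Frankel degree 2n) — the location statement behind NodalThetaSupport's 'nodal, k ≥ 2'.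
[difficulty: provable-now] [vanGeemen1994HodgeAV, Weil1977HodgeRing, Kleiman1968AlgebraicCycles]
#9 FourfoldSupportedClassesAlgebraic (support) — (calibration, theorem in print: the n = 2 case of
NodeDualClassesAlgebraic, for ALL smooth projective fourfolds) a rational (2,2)-class on a smooth
projective fourfold supported on a proper Zariski-closed subset is algebraic: DeligneHodgeIII1974
8.2.8 (tree fact Deligne1974_ker_restrictCompl_eq_iSup_range_complexGysin) + semisimplicity lift it
to a Hodge class in H²(D̃) of a resolution of the divisor, algebraic by Lefschetz (1,1)
(VoisinHodgeI2002 Thm 11.30; tree fact lefschetzOneOne_rational), and Gysin preserves algebraic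
classes — Thomas2005Nodes §3 with Totaro's Remark 1. This is why thimble-lattice certificates close
on fourfolds and why the whole difficulty of this route at n = 3 sits in NodeDualClassesAlgebraic.
[difficulty: L] [Thomas2005Nodes, DeligneHodgeIII1974, VoisinHodgeI2002]
#9 SixfoldSectorComplement (support) — (bookkeeping, NOT claimed) the complement of the route's
scope: (Weil classes on abelian sixfolds algebraic, = WeilSixfolds inlined) → HodgeConjecture.
Implied by HodgeConjecture itself, hence irrefutable short of ¬HC; filed only so that the D-0019
frame Crux → … → summit is explicit and shared with the other Weil-sector routes (TropicalCuspLift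
files the all-n analogue). Refuters: skip; provers: nothing to do unless HC is otherwise settled.
[difficulty: open-problem] [vanGeemen1994HodgeAV, MoonenZarhin1999, Deligne2000]

TWO-LAYER PLAN. Foreseen glued splits (nothing filed now; k ≤ 3, depth 1): NodalThetaSupport ⇐
NodalThetaMember (once effective divisors / |kΘ| / IsNodalDivisor are typed: the supporting set is a
nodal member of |kΘ|, k ≥ 2) → ThimbleRelationW (some vanishing-sphere relation has thimble class
with non-zero W-projection) → NodalThetaSupport, or by level KummerLevelTwo (k = 2, tangent
hyperplane sections of K(A) ⊂ ℙ⁶³) → HigherLevel (k ≥ 3) → NodalThetaSupport.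
NodeDualClassesAlgebraic ⇐ IsotropicThreefolds (node-dual classes of nodal theta divisors are
spanned by threefolds through the nodes with maximal-isotropic tangent spaces) → PrimitiveProjection
(Lieberman B(A): primitive projection of an algebraic class is algebraic) →
NodeDualClassesAlgebraic. ThetaConvolutionDetector (informal crux, rank 4) ⇐
GenericTannakaOnWeilLocus → BlindnessTheorem, or TannakaDrops → NamedCandidates.

KILL CRITERIA. Refuting WeilSixfolds, NodalThetaSupport or NodeDualClassesAlgebraic needs a
non-algebraic Weil class, i.e. ¬HC — then close `refuted:<Decl>` and the summit is decided. The
realistic kills hit the ENGINE: (a) ThetaConvolutionDetector finds G_Θ generic on the whole Weil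
locus AND ThetaBlindness is proved ⇒ smooth and convolution theta geometry is provably blind to W;
the route then reduces to a brute nodal search with ineffective k — close `exhausted` (census: the
no-go theorem is the output) unless the n = 2 calibration has found k_min ≤ 3; (b) n = 2 calibration
failure: on Schoen's ℚ(√−3) / van Geemen's ℚ(i) fourfolds, where the Weil cycle is known, no nodal
member of |2Θ| or |3Θ| carries it ⇒ the Kummer (k = 2) ansatz is dead; pivot NodalThetaSupport to k
≫ 0 existence only, i.e. supersede by TropicalCuspLift / sheaf-level theta geometry (Markman secant
sheaves); (c) a proof that node-dual classes of resolved nodal theta divisors of Weil sixfolds are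
as general as HC(2,2) for arbitrary general-type fourfold sections (no abelian structure survives) ⇒
the sixfold assembly is 'locator + test' only: close `superseded --by
route-HodgeConjecture-NodalSupport`, keeping NodalThetaSupport as a shared GHC-type item.
WeilSixfolds proved elsewhere (TropicalCuspLift; HeckePrymWeil covers only K = ℚ(√−7) in dimension
6; WeilConeBoundary only hyperbolic components) moots the route.

NOT DECOMPOSED YET. Nodality and |kΘ|-membership in the typed layer (needs effective Cartier
divisors with support, linear equivalence with kΘ, ampleness, and IsNode on the divisor — definition
requests below); the thimble lattice Λ_D, vanishing spheres and Picard–Lefschetz of the pencil (no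
Lefschetz pencils in the tree); the W-projector certificate Σ c_j⟨C,[k_j]_*C⟩ (needs intersection
pairing on H₆); the general-n versions of X1/X2 (n ≥ 4 all open; n = 2 is calibration); the
Tannakian detector and the blindness lemma (perverse sheaves, convolution, Gauss maps, Pontryagin
products: untypable today, filed as informal items right after open); the
generic-member-to-all-members passage is not needed (items quantify over every (A, φ)).

CHEAPEST FALSIFIER. The n = 2, k = 2 computation (kit-sized): for a Weil-type abelian fourfold in
Schoen's ℚ(√−3) family (period matrix with O_K-symmetry, level-2 theta constants to certified
precision), enumerate nodal hyperplane sections of the Kummer variety K(A) ⊂ ℙ¹⁵ (points of the dual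
variety with nodes off A[2]), compute the vanishing-sphere relations of the pencil by monodromy, and
test the exact certificate Σ_j c_j⟨C,[k_j]_*C⟩ ≠ 0 on each relation's thimble class: HC is a theorem
there (Markman2025SecantWeil), so SOME (k, D) must work — if k = 2 and k = 3 both fail, the explicit
half of the line is dead (kill (b)). Cheaper still, two lookups: Schoen1985 (acq-02478, paywalled
here) — does his method already produce the node-dual cycles for nodal divisors with nodes in
special position? — and Krämer–Weissauer arXiv:1309.3754 §1: is G_Θ for g = 4, 6 already known to be
generic on positive-dimensional special loci containing the Weil locus? Not run this session
(searchd/galaxy intermittent, arXiv/OpenAlex rate-limited).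

NUMBERS. Weil locus: dimension n² = 9 inside A₆ (dim 21), 4 inside A₄ (dim 10); B³(A) = ℚθ³ ⊕ W_K,
dim 3, for the general member (vanGeemen1994HodgeAV Thm 4.11, 6.12); |2Θ| = ℙ^{2^{2n}−1}: ℙ¹⁵ (n =
2), ℙ⁶³ (n = 3); Gauss degree of a smooth theta divisor g! = 24, 720 (dimension of the
Krämer–Weissauer fibre functor, arXiv:1309.3754); known cases of the target: n = 2 all K and
discriminants (Markman2025SecantWeil and sequel), n = 3 discriminant −1 all K
(Markman2025SecantWeil), K = ℚ(√−3) trivial discriminant (Schoen1988HodgeWeil); everything else open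
(arXiv:2603.20268 §1). Items at open: 7 typed (1 target, 2 cruxes, 3 supports, 1 assembly) + 2
informal to be filed (crux ThetaConvolutionDetector rank 4, support ThetaBlindness) = 9 ≤ 15.

DEFINITION REQUESTS. (1) IsNodalDivisor (topic Literature/AlgebraicGeometry/HodgeTheory): a reduced
effective Cartier divisor D on a smooth variety whose non-regular points are finitely many nodes
(`IsNode ℂ (dim − 1)`), i.e. `IsNodalHypersurface` with ℙⁿ⁺¹ replaced by an arbitrary smooth
ambient, with its support as a `Set X.left`; (2) membership of an effective divisor in |kL| for an
ample line bundle / polarization of an abelian variety (topic Literature/AlgebraicGeometry/Motives,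
on top of CartierDivisor*): needed to type the sharp form of NodalThetaSupport; (3) long-term:
vanishing cycles and the thimble lattice of a Lefschetz degeneration. Cite facts wanted: Markman
2025 (Weil fourfolds, all discriminants) as a named fact to discharge the n = 2 calibration;
Krämer–Weissauer generic Tannaka group (arXiv:1309.3754 Thm 1).

Novelty: Searches (2026-08-15): `lit search --hybrid "nodes Hodge conjecture Thomas vanishing cycles ordinary
double points"` (10 book hits: Voisin II, Kerr–Pearlstein volume, Green–Murre–Voisin; none on
abelian varieties); `lit frontier HodgeConjecture --since 2021` (30 rows; relevant arXiv:2603.20268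
sixfold status, arXiv:2211.16042 theta divisors and permutohedra); `lit bridges HodgeConjecture
--cross any` (30 rows, none relevant); `lit galaxy search "nodal theta divisor Weil type" --star
all` (0/0/0) and `"theta divisor and the Hodge conjecture" --star all` (0/0/0); zbMATH `Schoen
algebraic cycles desingularized nodal hypersurfaces` (→ Schoen1985, paywalled, acq-02478); READ
Thomas2005Nodes pp.1–9 (arXiv:math/0212216), arXiv:2603.20268 pp.1–3, arXiv:1410.5868 pp.1–3; the
card's novelty audit (refuter r19, 2026-08-15: new-combination; nearest uncited programme Izadi–Wang
/ Izadi–Tamás–Wang primal cohomology; correctness flag on the n = 3 conjunct, adopted here as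
NodeDualClassesAlgebraic); arXiv/OpenAlex API rate-limited this session (429), searchd intermittent.
Nearest prior art found: Thomas2005Nodes (the nodal criterion, all X, a GLOBAL equivalence);
Schoen1985 (node-dual classes on desingularised nodal hypersurfaces — the X2 problem in ℙⁿ); route
NodalSupport (MiddleDivisorSupport ∀X, conditional bridge) and card
thimble-lattice-nodal-certificates (fourfolds, X2 free by Lefschetz (1,1)); arXiv:1410.5868
(primitive cohomology of SMOOTH Θ, GHC for K_Θ, g ≤ 5 — Hodge theory OF Θ,  [refs: 2603.20268, 2211.16042, math/0212216, 1410.5868, 1309.3754, 1111.4947, 1501.00226, 2210.05166, Schoen1985]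

Barriers (technique_class: weil-classes, theta-divisors, vanishing-cycles): - technique_class: weil-classes, theta-divisors, vanishing-cycles
- Literature.Barriers.HodgeConjecture.Weil1977_exceptionalHodgeClasses: this is the target sector;
the line never multiplies divisor classes — WeilClassesPrimitive shows the divisor ring ANNIHILATES
the Weil plane — and the cycles are to come from node-dual classes of SINGULAR members of |kΘ|
(outside Dⁿ by construction) or from Tannaka-named subvarieties.
- Literature.Barriers.HodgeConjecture.Mumford1968_simpleFourfold_exceptionalHodgeClasses: fourfolds
are calibration only (Markman's theorem); same evasion, and FourfoldSupportedClassesAlgebraic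
records why n = 2 closes unconditionally.
- Literature.Barriers.HodgeConjecture.Voisin2003_generalHypersurface_noIntegralClassInF: no normal
functions, Abel–Jacobi inversion or Jacobian-ring argument is used; nodal members and explicit
vanishing-sphere relations replace singularities of normal functions (Thomas's reformulation), and
the ambient is an abelian variety, not a general hypersurface.
- Literature.Barriers.HodgeConjecture.Grothendieck1969_generalHodgeConjecture_false:
NodalThetaSupport asserts coniveau ≥ 1 only for HODGE classes (level 0), where Grothendieck's
correction to GHC is vacuous; no positive-level sub-Hodge structure is claimed supported.
- Literature.Barriers.HodgeConjecture.Andre1996_hodgeClassesOnAbelianVarieties_motivated: consistent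
— the line is constructive; a negative detector outcome is a no-go theorem for theta geometry, never
a counterexa

History (route lifecycle, newest last):
- 2026-09-02T13:25:28Z · DORMANT — reconciler: no traction for 5 d (last activity item-evidence-added at 2026-08-28T12:32:47Z); parked, not closed — `ledger route dormant route-HodgeConjecture-No (operator:999:3506370)

sub-problem: HodgeConjecture · status: dormant · opened planner-plancard-HodgeConjecture-HodgeConject-60ab7008-0 2026-08-15T12:17:56Z · rev 3 · ledger route-HodgeConjecture-NodalThetaWeil
GENERATED by the gate from the ledger (D-0016/17). Provers cite these decls: `theorem foo : Summit.HodgeConjecture.HodgeConjecture.Theses.NodalThetaWeil.<Decl> := …` in Summits/HodgeConjecture/HodgeConjecture/Theorems/<Name>.lean.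
-/

namespace Summit.HodgeConjecture.HodgeConjecture.Theses.NodalThetaWeil

open scoped BigOperators Topology Manifold Classical MeasureTheory ProbabilityTheory Matrix InnerProductSpace ComplexConjugate ContinuousMap
open Filter Set Function TopologicalSpace MeasureTheory

attribute [summit_statement] _root_.HodgeConjecture

/-- item stmt-HodgeConjecture-2524 · target · rank 0 · open · by planner
why it might fail: It is HC for Weil classes on abelian sixfolds: open for every K off the discriminant −1 components (arXiv:2603.20268 p.3; Voisin2025GHCConiveauSurvey §3.3; Markman2025SecantWeil did disc −1, Schoen ℚ(√−3) trivial disc); false iff one of Weil's 1977 candidate counterexamples is real.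
sources: vanGeemen1994HodgeAV, Weil1977HodgeRing, Markman2025SecantWeil, arXiv:2603.20268, MoonenZarhin1999, Voisin2025GHCConiveauSurvey
[crux, rank 3] X(3): Weil classes on abelian SIXFOLDS (A, φ² = -d) are algebraic — the thesis at n =
3, inlined. Markman (arXiv:2502.03415) proves it on the components of discriminant -1 for every K =
ℚ(√-d) via a simple reflexive secant sheaf on X×X̂ (X an abelian threefold) deformed by
Buchweitz–Flenner semiregularity over the 9-dimensional Weil moduli; Schoen did K = ℚ(√-3), trivial
discriminant. By the Witt-index dictionary the disc ≡ -1 components are exactly the ones with a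
totally toric (maximal unipotent) cusp; the open components (disc ≢ -1) have Witt index 2: their
deepest degeneration has torus rank 4 over a (1,1) K-abelian surface (E×E with K ⊂ M₂(ℚ)), and their
depth-1 cusps sit over level-2 Weil fourfolds of discriminant -disc, where Markman's theorem AND his
semiregular secant sheaves are available — so X(3) is ONE application of the depth-1 lift
(WittTowerStep at n = 2) away from print, which is why it is ranked right after the step. It is also
the natural shared target of the direct attacks filed as other cards (weil-discriminant-exposed-ray:
exposed rays rational iff (-1)^n det H trivial; volume-form-lagrangians-weil-classes;
mirror-lagrangian-branes-for-weil-clas -/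
@[route_item "route-HodgeConjecture-NodalThetaWeil"]
def WeilSixfolds : Prop :=
  ∀ (d : ℕ), 0 < d → ∀ (A : Literature.AlgebraicGeometry.Motives.AbelianVariety ℂ) (φ : A ⟶ A), A.dim = 2 * 3 → Literature.AlgebraicGeometry.Motives.IsSmoothProjective (2 * 3) A.X → CategoryTheory.CategoryStruct.comp φ φ = -(d • CategoryTheory.CategoryStruct.id A) → ∀ c : Literature.AlgebraicTopology.SingularHomology.singularCohomology ℂ ℂ (Literature.AlgebraicGeometry.Motives.ComplexPoints A.X) (2 * 3), Literature.AlgebraicGeometry.HodgeTheory.IsRationalClass c → Literature.AlgebraicGeometry.HodgeTheory.IsOfHodgeType (2 * 3) A.X (2 * 3) 3 3 c → (∃ c₁ c₂ : Literature.AlgebraicTopology.SingularHomology.singularCohomology ℂ ℂ (Literature.AlgebraicGeometry.Motives.ComplexPoints A.X) (2 * 3), c = c₁ + c₂ ∧ (∀ x y : ℕ, Literature.AlgebraicTopology.SingularHomology.singularCohomology.map ℂ ℂ (Literature.AlgebraicGeometry.Motives.AlgPoints.mapContinuous (L := ℂ) (x • CategoryTheory.CategoryStruct.id A + y • φ).hom.hom.hom)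 (2 * 3) c₁ = ((x : ℂ) + (y : ℂ) * Complex.I * (Real.sqrt d : ℂ)) ^ (2 * 3) • c₁) ∧ (∀ x y : ℕ, Literature.AlgebraicTopology.SingularHomology.singularCohomology.map ℂ ℂ (Literature.AlgebraicGeometry.Motives.AlgPoints.mapContinuous (L := ℂ) (x • CategoryTheory.CategoryStruct.id A + y • φ).hom.hom.hom) (2 * 3) c₂ = ((x : ℂ) - (y : ℂ) * Complex.I * (Real.sqrt d : ℂ)) ^ (2 * 3) • c₂)) → c ∈ Literature.AlgebraicGeometry.HodgeTheory.algebraicClasses A.X 3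

/-- item stmt-HodgeConjecture-7744 · crux · rank 2 · open · by planner
why it might fail: False iff a Weil class on a Weil-type abelian sixfold has geometric coniveau 0, forcing ¬HC (Weil's 1977 candidates; open off disc −1: arXiv:2603.20268 p.3, Voisin2025GHCConiveauSurvey §3.3); coniveau ≥ 1 was never proved for an exceptional class except via algebraicity; Thomas's N is ineffective.
sources: Thomas2005Nodes, Weil1977HodgeRing, arXiv:2603.20268, Voisin2025GHCConiveauSurvey, vanGeemen1994HodgeAV, arXiv:1410.5868
[crux] (card C2, typed envelope) every Weil class on an abelian sixfold of Weil type (A, φ ≫ φ =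
−d·𝟙) — rational, of type (3,3), in the Weil plane — lies in N¹H⁶: it is supported on a proper
Zariski-closed subset. Intended sharp form, informal until divisors/linear systems are typed: the
subset is a NODAL member D of |kΘ| for some k ≥ 2 and w enters through a relation Σ aᵢδᵢ = ∂Γ among
the vanishing spheres of D whose thimble class has non-zero W-projection (certificate Σ_j
c_j⟨C,[k_j]_*C⟩ ≠ 0, π_W a polynomial in the K-action); by primitivity no smooth member and no
divisor with Lefschetz-standard H₆ can work; first regime k = 2 (hyperplane sections tangent to the
Kummer variety). [difficulty: open-problem] -/
@[route_item "route-HodgeConjecture-NodalThetaWeil"]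
def NodalThetaSupport : Prop :=
  ∀ (d : ℕ), 0 < d → ∀ (A : Literature.AlgebraicGeometry.Motives.AbelianVariety ℂ) (φ : A ⟶ A), A.dim = 2 * 3 → Literature.AlgebraicGeometry.Motives.IsSmoothProjective (2 * 3) A.X → CategoryTheory.CategoryStruct.comp φ φ = -(d • CategoryTheory.CategoryStruct.id A) → ∀ c : Literature.AlgebraicTopology.SingularHomology.singularCohomology ℂ ℂ (Literature.AlgebraicGeometry.Motives.ComplexPoints A.X) (2 * 3), Literature.AlgebraicGeometry.HodgeTheory.IsRationalClass c → Literature.AlgebraicGeometry.HodgeTheory.IsOfHodgeType (2 * 3) A.X (2 * 3) 3 3 c → (∃ c₁ c₂ : Literature.AlgebraicTopology.SingularHomology.singularCohomology ℂ ℂ (Literature.AlgebraicGeometry.Motives.ComplexPoints A.X) (2 * 3), c = c₁ + c₂ ∧ (∀ x y : ℕ, Literature.AlgebraicTopology.SingularHomology.singularCohomology.map ℂ ℂ (Literature.AlgebraicGeometry.Motives.AlgPoints.mapContinuous (L := ℂ) (x • CategoryTheory.CategoryStruct.id A + y • φ).hom.hom.hom) (2 * 3) c₁ = ((x : ℂ)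 + (y : ℂ) * Complex.I * (Real.sqrt d : ℂ)) ^ (2 * 3) • c₁) ∧ (∀ x y : ℕ, Literature.AlgebraicTopology.SingularHomology.singularCohomology.map ℂ ℂ (Literature.AlgebraicGeometry.Motives.AlgPoints.mapContinuous (L := ℂ) (x • CategoryTheory.CategoryStruct.id A + y • φ).hom.hom.hom) (2 * 3) c₂ = ((x : ℂ) - (y : ℂ) * Complex.I * (Real.sqrt d : ℂ)) ^ (2 * 3) • c₂)) → c ∈ Literature.AlgebraicGeometry.HodgeTheory.supportedClasses A.X (2 * 3) 1

/-- item stmt-HodgeConjecture-7745 · crux · rank 3 · open · by planner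
why it might fail: It is HC(2,2) for the lifted node-dual classes B̄ ∈ H⁴(D̃) of resolved (nodal) theta 5-folds of general type — 'itself a hard unsolved problem' (Thomas2005Nodes §1, §3 Lemmas 3–4; Schoen1985); one dimension down only Lefschetz (1,1) is available (n = 2), no method at n = 3; false only with ¬HC.
sources: Thomas2005Nodes, Schoen1985, DeligneHodgeIII1974, Lieberman1968, Voisin2025GHCConiveauSurvey
[crux] (the audit's missing conjunct) a Weil class on an abelian sixfold of Weil type that IS
supported on a proper Zariski-closed subset is algebraic. By DeligneHodgeIII1974 Cor. 8.2.8 +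
semisimplicity the class is the Gysin image of a Hodge class B̄ ∈ H^{2,2}(D̃) on a resolution of the
supporting divisor, and by Thomas2005Nodes §3 eq. (d) (= Schoen1985 Lemma 1.1) for NODAL D the new
Hodge classes of D̃⁵ are exactly the node-dual lattice ⟨Aᵢ − Bᵢ⟩^* of relations among vanishing
spheres; the statement is HC for those classes (their primitive projections, algebraic by
Lieberman1968 B(A)), expected to be carried by threefolds V ⊂ D through the nodes with T_pV maximal
isotropic for the Hessian quadric. [deps: NodalThetaSupport] [difficulty: open-problem] -/
@[route_item "route-HodgeConjecture-NodalThetaWeil"]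
def NodeDualClassesAlgebraic : Prop :=
  ∀ (d : ℕ), 0 < d → ∀ (A : Literature.AlgebraicGeometry.Motives.AbelianVariety ℂ) (φ : A ⟶ A), A.dim = 2 * 3 → Literature.AlgebraicGeometry.Motives.IsSmoothProjective (2 * 3) A.X → CategoryTheory.CategoryStruct.comp φ φ = -(d • CategoryTheory.CategoryStruct.id A) → ∀ c : Literature.AlgebraicTopology.SingularHomology.singularCohomology ℂ ℂ (Literature.AlgebraicGeometry.Motives.ComplexPoints A.X) (2 * 3), Literature.AlgebraicGeometry.HodgeTheory.IsRationalClass c → Literature.AlgebraicGeometry.HodgeTheory.IsOfHodgeType (2 * 3) A.X (2 * 3) 3 3 c → (∃ c₁ c₂ : Literature.AlgebraicTopology.SingularHomology.singularCohomology ℂ ℂ (Literature.AlgebraicGeometry.Motives.ComplexPoints A.X) (2 * 3), c = c₁ + c₂ ∧ (∀ x y : ℕ, Literature.AlgebraicTopology.SingularHomology.singularCohomology.map ℂ ℂ (Literature.AlgebraicGeometry.Motives.AlgPoints.mapContinuous (L := ℂ) (x • CategoryTheory.CategoryStruct.id A + y • φ).hom.hom.hom) (2 * 3) c₁ = ((x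 : ℂ) + (y : ℂ) * Complex.I * (Real.sqrt d : ℂ)) ^ (2 * 3) • c₁) ∧ (∀ x y : ℕ, Literature.AlgebraicTopology.SingularHomology.singularCohomology.map ℂ ℂ (Literature.AlgebraicGeometry.Motives.AlgPoints.mapContinuous (L := ℂ) (x • CategoryTheory.CategoryStruct.id A + y • φ).hom.hom.hom) (2 * 3) c₂ = ((x : ℂ) - (y : ℂ) * Complex.I * (Real.sqrt d : ℂ)) ^ (2 * 3) • c₂)) → c ∈ Literature.AlgebraicGeometry.HodgeTheory.supportedClasses A.X (2 * 3) 1 → c ∈ Literature.AlgebraicGeometry.HodgeTheory.algebraicClasses A.X 3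

-- item stmt-HodgeConjecture-8329 · support · rank 4 · open · by planner — informal only, no Lean statement yet:
--   [crux, rank 4 — card (D), untyped: no perverse sheaves / Tannakian convolution in the tree]
--   ThetaConvolutionDetector: determine the Tannakian group G_Θ (Krämer–Weissauer arXiv:1111.4947,
--   arXiv:1309.3754: generic ppav ⇒ G_Θ = SO(g!) or Sp(g!) by parity, fibre functor of dimension g! =
--   Gauss degree) of the perverse sheaf δ_Θ under convolution for the general PRINCIPALLY polarised
--   abelian variety of Weil type of dimension 4 and 6, for each K: generic or dropping? Inputs: g! via
--   the Gauss map (needs Θ smooth on the Weil locus, or its Chern–Mather correction — sub-question: is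
--   the n²-dimensional We

/-- item stmt-HodgeConjecture-14234 · support · rank 9 · closed · proved by Summit.HodgeConjecture.HodgeConjecture.Theorems.nodalThetaWeil_weilSixfoldsOfNodalTheta_proof @ 99c4ab32d48c (prover) · by planner
[support] (glue, route-choice repair 2026-08-16 — makes the target WeilSixfolds reachable from the
cruxes; option (a) of the operator hold route.target-unreachable) the two cruxes imply the target:
NodalThetaSupport → NodeDualClassesAlgebraic → WeilSixfolds. Pure logic over the syntactically
identical Weil-sixfold binder block (d, A, φ, c with its eleven hypotheses): NodalThetaSupport puts
the Weil class c in supportedClasses A.X (2*3) 1, NodeDualClassesAlgebraic turns a supported Weil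
class into a member of algebraicClasses A.X 3, which is the conclusion of WeilSixfolds. Checked in
the planner's Sketch.lean against the route module (lean check rc 0, 0 sorries, 2026-08-16) with the
term `fun h₁ h₂ d hd A φ hdim hsp hφ c hr hh hw => h₂ d hd A φ hdim hsp hφ c hr hh hw (h₁ d hd A φ
hdim hsp hφ c hr hh hw)`; also SixfoldSectorComplement ↔ (WeilSixfolds → HodgeConjecture) is
Iff.rfl, so glue + SixfoldSectorComplement re-derive the certified deciding theorem closes.
Difficulty XS — any idle prover can land `theorem … : NodalThetaWeil.WeilSixfoldsOfNodalTheta` in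
Theorems/ with that term. Sources: Thomas2005Nodes (the X1/X2 split of the nodal criterion),
Deligne2000. -/
@[route_item "route-HodgeConjecture-NodalThetaWeil"]
def WeilSixfoldsOfNodalTheta : Prop :=
  NodalThetaSupport → NodeDualClassesAlgebraic → WeilSixfolds

-- `WeilSixfoldsOfNodalTheta` holds: proved by `Summit.HodgeConjecture.HodgeConjecture.Theorems.nodalThetaWeil_weilSixfoldsOfNodalTheta_proof` @ 99c4ab32d48c (its module imports this route file, so no `_holds` link can be stated here).

/-- item stmt-HodgeConjecture-7746 · support · rank 9 · closed · proved by Summit.HodgeConjecture.HodgeConjecture.Theorems.nodalThetaWeil_weilClassesPrimitive_proof @ 0dc0df48801b (prover) · by planner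
sources: vanGeemen1994HodgeAV, Weil1977HodgeRing, Kleiman1968AlgebraicCycles
[support] (card (P), provable now) for (A, φ ≫ φ = −d·𝟙) of dimension 2n, n ≥ 1, assuming the
character decomposition of H^{2n+2}(A(ℂ);ℂ) into simultaneous (x𝟙 + yφ)^*-eigenclasses of characters
(x + iy√d)^a (x − iy√d)^b with a + b = 2n + 2, a, b ≤ 2n (= ∧^{2n+2}(V₊ ⊕ V₋),
Kleiman1968AlgebraicCycles 2A8–2A11 / vanGeemen1994HodgeAV 4.9; dischargeable once complexBetti is a
Weil cohomology), every degree-2 class e with (x𝟙 + yφ)^* e = (x² + dy²) e (a K-hermitian class,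
e.g. c₁ of any polarization with φ^*θ = dθ, i.e. whose Rosati involution induces conjugation on K)
satisfies e ∪ w = 0 for every w in the Weil plane: e ∪ w₊ is an eigenclass of the forbidden
character (x + iy√d)^{2n+1}(x − iy√d), absent from the decomposition (distinct characters of one
operator (x₀𝟙 + φ)^* ⇒ independent eigenspaces). Consequences (informal): w is primitive; w
restricts to 0 on every SMOOTH ample divisor (Gysin is injective there), while on a NODAL D ∈ |kΘ|
its restriction to the resolution D̃ lies in the span of the differences Aᵢ − Bᵢ of the rulings of
the exceptional quadrics (Thomas2005Nodes eq. (dd)) — theta sees w only through its nodes; w is not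
supported on any divisor whose H₆-image is Lefsche -/
@[route_item "route-HodgeConjecture-NodalThetaWeil"]
def WeilClassesPrimitive : Prop :=
  ∀ (d : ℕ), 0 < d → ∀ (n : ℕ), 1 ≤ n → ∀ (A : Literature.AlgebraicGeometry.Motives.AbelianVariety ℂ) (φ : A ⟶ A), A.dim = 2 * n → Literature.AlgebraicGeometry.Motives.IsSmoothProjective (2 * n) A.X → CategoryTheory.CategoryStruct.comp φ φ = -(d • CategoryTheory.CategoryStruct.id A) → (∀ c' : Literature.AlgebraicTopology.SingularHomology.singularCohomology ℂ ℂ (Literature.AlgebraicGeometry.Motives.ComplexPoints A.X) (2 * n + 2), c' ∈ ⨆ (a : ℕ) (b : ℕ) (_ : a + b = 2 * n + 2) (_ : a ≤ 2 * n) (_ : b ≤ 2 * n), Literature.AlgebraicGeometry.HodgeTheory.pullbackEigenclasses A φ (2 * n + 2) (fun x y => (((x : ℂ) + (y : ℂ) * Complex.I * (Real.sqrt d : ℂ)) ^ a) * (((x : ℂ) - (y : ℂ) * Complex.I * (Real.sqrt d : ℂ)) ^ b))) → ∀ e : Literature.AlgebraicTopology.SingularHomology.singularCohomology ℂ ℂ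 (Literature.AlgebraicGeometry.Motives.ComplexPoints A.X) 2, e ∈ Literature.AlgebraicGeometry.HodgeTheory.pullbackEigenclasses A φ 2 (fun x y => ((x : ℂ) + (y : ℂ) * Complex.I * (Real.sqrt d : ℂ)) * ((x : ℂ) - (y : ℂ) * Complex.I * (Real.sqrt d : ℂ))) → ∀ c : Literature.AlgebraicTopology.SingularHomology.singularCohomology ℂ ℂ (Literature.AlgebraicGeometry.Motives.ComplexPoints A.X) (2 * n), c ∈ Literature.AlgebraicGeometry.HodgeTheory.weilClassesOf A φ n d → Literature.AlgebraicTopology.SingularHomology.cupProduct (R := ℂ) (add_comm 2 (2 * n)) e c = 0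

-- `WeilClassesPrimitive` holds: proved by `Summit.HodgeConjecture.HodgeConjecture.Theorems.nodalThetaWeil_weilClassesPrimitive_proof` @ 0dc0df48801b (its module imports this route file, so no `_holds` link can be stated here).

/-- item stmt-HodgeConjecture-7747 · support · rank 9 · closed · proved by Summit.HodgeConjecture.HodgeConjecture.Theorems.nodalThetaWeil_fourfoldSupportedClassesAlgebraic_proof @ 679ec515c842 (prover) · by planner
sources: Thomas2005Nodes, DeligneHodgeIII1974, VoisinHodgeI2002
[support] (calibration, theorem in print: the n = 2 case of NodeDualClassesAlgebraic, for ALL smooth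
projective fourfolds) a rational (2,2)-class on a smooth projective fourfold supported on a proper
Zariski-closed subset is algebraic: DeligneHodgeIII1974 8.2.8 (tree fact
Deligne1974_ker_restrictCompl_eq_iSup_range_complexGysin) + semisimplicity lift it to a Hodge class
in H²(D̃) of a resolution of the divisor, algebraic by Lefschetz (1,1) (VoisinHodgeI2002 Thm 11.30;
tree fact lefschetzOneOne_rational), and Gysin preserves algebraic classes — Thomas2005Nodes §3 with
Totaro's Remark 1. This is why thimble-lattice certificates close on fourfolds and why the whole
difficulty of this route at n = 3 sits in NodeDualClassesAlgebraic. [difficulty: L] -/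
@[route_item "route-HodgeConjecture-NodalThetaWeil"]
def FourfoldSupportedClassesAlgebraic : Prop :=
  ∀ ⦃X : Literature.AlgebraicGeometry.Motives.SchemeOver ℂ⦄, Literature.AlgebraicGeometry.Motives.IsSmoothProjective 4 X → ∀ c : Literature.AlgebraicGeometry.HodgeTheory.complexBetti X 4, Literature.AlgebraicGeometry.HodgeTheory.IsRationalClass c → Literature.AlgebraicGeometry.HodgeTheory.IsOfHodgeType 4 X 4 2 2 c → c ∈ Literature.AlgebraicGeometry.HodgeTheory.supportedClasses X 4 1 → c ∈ Literature.AlgebraicGeometry.HodgeTheory.algebraicClasses X 2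

-- `FourfoldSupportedClassesAlgebraic` holds: proved by `Summit.HodgeConjecture.HodgeConjecture.Theorems.nodalThetaWeil_fourfoldSupportedClassesAlgebraic_proof` @ 679ec515c842 (its module imports this route file, so no `_holds` link can be stated here).

/-- item stmt-HodgeConjecture-7748 · support · rank 9 · open · by planner
sources: vanGeemen1994HodgeAV, MoonenZarhin1999, Deligne2000
[support] (bookkeeping, NOT claimed) the complement of the route's scope: (Weil classes on abelian
sixfolds algebraic, = WeilSixfolds inlined) → HodgeConjecture. Implied by HodgeConjecture itself,
hence irrefutable short of ¬HC; filed only so that the D-0019 frame Crux → … → summit is explicit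
and shared with the other Weil-sector routes (TropicalCuspLift files the all-n analogue). Refuters:
skip; provers: nothing to do unless HC is otherwise settled. [difficulty: open-problem] -/
@[route_item "route-HodgeConjecture-NodalThetaWeil"]
def SixfoldSectorComplement : Prop :=
  (∀ (d : ℕ), 0 < d → ∀ (A : Literature.AlgebraicGeometry.Motives.AbelianVariety ℂ) (φ : A ⟶ A), A.dim = 2 * 3 → Literature.AlgebraicGeometry.Motives.IsSmoothProjective (2 * 3) A.X → CategoryTheory.CategoryStruct.comp φ φ = -(d • CategoryTheory.CategoryStruct.id A) → ∀ c : Literature.AlgebraicTopology.SingularHomology.singularCohomology ℂ ℂ (Literature.AlgebraicGeometry.Motives.ComplexPoints A.X) (2 * 3), Literature.AlgebraicGeometry.HodgeTheory.IsRationalClass c → Literature.AlgebraicGeometry.HodgeTheory.IsOfHodgeType (2 * 3) A.X (2 * 3) 3 3 c → (∃ c₁ c₂ : Literature.AlgebraicTopology.SingularHomology.singularCohomology ℂ ℂ (Literature.AlgebraicGeometry.Motives.ComplexPoints A.X) (2 * 3), c = c₁ + c₂ ∧ (∀ x y : ℕ, Literature.AlgebraicTopology.SingularHomology.singularCohomology.map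 ℂ ℂ (Literature.AlgebraicGeometry.Motives.AlgPoints.mapContinuous (L := ℂ) (x • CategoryTheory.CategoryStruct.id A + y • φ).hom.hom.hom) (2 * 3) c₁ = ((x : ℂ) + (y : ℂ) * Complex.I * (Real.sqrt d : ℂ)) ^ (2 * 3) • c₁) ∧ (∀ x y : ℕ, Literature.AlgebraicTopology.SingularHomology.singularCohomology.map ℂ ℂ (Literature.AlgebraicGeometry.Motives.AlgPoints.mapContinuous (L := ℂ) (x • CategoryTheory.CategoryStruct.id A + y • φ).hom.hom.hom) (2 * 3) c₂ = ((x : ℂ) - (y : ℂ) * Complex.I * (Real.sqrt d : ℂ)) ^ (2 * 3) • c₂)) → c ∈ Literature.AlgebraicGeometry.HodgeTheory.algebraicClasses A.X 3) → HodgeConjecture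

-- item stmt-HodgeConjecture-8330 · support · rank 9 · open · by planner — informal only, no Lean statement yet:
--   [support — card (N), provable on paper now, untyped: no Pontryagin product / Gauss map / Thom
--   polynomials in the tree] ThetaBlindness: on a ppav (A, Θ) with NS_ℚ = ℚθ and Θ SMOOTH, (a)
--   Beauville–Mukai Fourier duality gives θ^i ⋆ θ^j ∈ ℚθ^{i+j−g} (Pontryagin product; Beauville, 'Sur
--   l'anneau de Chow d'une variété abélienne', Math. Ann. 273 (1986); Mukai 1981), so every class
--   obtained from Θ by the group law (Θ+…+Θ, fibres and images of the addition maps Θ^m → A) and by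
--   Thom–Porteous / Kazarian multisingularity classes of these maps on strata of EXPECTED dimension lies
--   in ℚ[θ]; (b) the Gauss map

/-- item stmt-HodgeConjecture-7749 · assembly · rank 1 · closed · proved by Summit.HodgeConjecture.HodgeConjecture.Theorems.nodalThetaWeil_assembly_proof @ c81700764b6c (prover) · by planner
sources: Thomas2005Nodes, Deligne2000
[assembly] NodalThetaSupport → NodeDualClassesAlgebraic → SixfoldSectorComplement → HodgeConjecture. -/
@[route_item "route-HodgeConjecture-NodalThetaWeil"]
def Assembly : Prop :=
  NodalThetaSupport → NodeDualClassesAlgebraic → SixfoldSectorComplement → HodgeConjecture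

-- `Assembly` holds: proved by `Summit.HodgeConjecture.HodgeConjecture.Theorems.nodalThetaWeil_assembly_proof` @ c81700764b6c (its module imports this route file, so no `_holds` link can be stated here).

/-! D-0027 §2.1 — DECIDING THEOREM (planner-authored via `route open/edit --closes-file`; by planner-rbadge-HodgeConjecture-NodalThetaWeil-5402c7bb-g2-0 2026-08-15T16:11:32Z):
its hypotheses are this route's items and its conclusion the sub-problem Statement (glue_lint), and it elaborates with this file. -/

/-- D-0027 §2.1 deciding theorem of route NodalThetaWeil. The load-bearing logic is the thesis
X1 ∧ X2 ⇒ WeilSixfolds ⇒ HodgeConjecture over syntactically identical binder blocks: given the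
Weil-sixfold datum `(d, A, φ, c)` with its eleven hypotheses, `NodalThetaSupport` (crux, rank 2)
puts the Weil class `c` in N¹H⁶ (`supportedClasses A.X 6 1`), `NodeDualClassesAlgebraic` (crux,
rank 3) turns a supported Weil class into an algebraic one (`algebraicClasses A.X 3`) — together this
is exactly the antecedent of the declared, NOT-claimed sector frame `SixfoldSectorComplement :
(WeilSixfolds inlined) → HodgeConjecture`, which carries the Weil-sixfold sector to the summit. The
informal items ThetaConvolutionDetector / ThetaBlindness (no Lean decls yet) and the calibration
supports are deliberately not hypotheses. -/
@[closes "route-HodgeConjecture-NodalThetaWeil"] theorem closes (h₁ : NodalThetaSupport) (h₂ : NodeDualClassesAlgebraic)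
    (h₃ : SixfoldSectorComplement) : _root_.HodgeConjecture :=
  h₃ fun d hd A φ hdim hsp hφ c hr hh hw =>
    h₂ d hd A φ hdim hsp hφ c hr hh hw (h₁ d hd A φ hdim hsp hφ c hr hh hw)

end Summit.HodgeConjecture.HodgeConjecture.Theses.NodalThetaWeil
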